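import Summits.Langlands.Langlands.Theses.DyadicOddResidue
import Summits.Langlands.Langlands.Theorems.DyadicOddResidueDyadicDihedralFMDictionary
import Summits.Langlands.Langlands.Theorems.AbelianSurfaceSerreQuadraticImprimitiveSurfacesCliffordInduced
import Literature.NumberTheory.Automorphic.FontaineMazurHilbertTotallySplit
import Literature.NumberTheory.Automorphic.IsAutomorphicAE
import Literature.NumberTheory.GaloisRepresentations.FramedGaloisRepInduce
import HarnessLib

/-!
# Stub A `stub_inducedCase` of the crux `DyadicOddResidue.DyadicEisensteinFM` (stmt-Langlands-18741):
# the induced (CM) leg, REDUCED to the automorphy of the inducing character / to a Tate-twist newform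

Lines `ordinary-seed-propagation` and `close-approximation-cc` (shared stub, verbatim) split the
crux — Fontaine–Mazur for `GL₂/ℚ` at `ℓ = 2` — on "`ρ` becomes reducible over some quadratic
number field `K`".  Stub A is that leg:

> `ρ : Γ_ℚ → GL₂(ℚ̄₂)` continuous, irreducible, unramified almost everywhere, de Rham at `2`
> (Fontaine's pinned datum) with multiplicity-free labelled Hodge–Tate weights, and
> `ρ|_{Γ_K}` reducible for a quadratic number field `K` ⟹ `IsAutomorphicAE ι hcpt ρ`.

It is printed mathematics modulo the automorphic dictionary (Clifford ⟹ `ρ ≅ Ind_{Γ_K}^{Γ_ℚ} θ`;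
distinct weights ⟹ `K` imaginary and `θ` the `2`-adic avatar of an algebraic Hecke character
`ψ` of `K`, Serre 1968 Ch. III / Patrikis 2019 Prop. 2.2.1 and Lemma 2.2.4; `π(ψ)` the
automorphic induction = Hecke's CM newform, Hecke 1927, Shimura 1971, Ribet 1977 Thm. (3.4) and
(4.5), Jacquet–Langlands §12).  This `--supports` helper lands the part of that chain the tree can
certify today, as kernel-checked reductions (no `sorry`, no new fact):

* `satakeFrobCompatibleAE_of_charpoly_eq`, `isAutomorphicAE_of_charpoly_eq` — **automorphy is a
  function of the characteristic polynomials** (plus a.e. unramifiedness of the partner): if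
  `det(X - ρ(σ)) = det(X - ρ'(σ))` for all `σ` and `ρ` is unramified almost everywhere, every
  `π` attached to `ρ'` at almost all places is attached to `ρ`.
* `exists_character_charpoly_eq_induce` — **Clifford, rank two** (from the landed index-two
  Clifford theorem `…QuadraticImprimitiveSurfaces.Clifford.exists_charpoly_eq_charpoly_induce_of_not_isIrreducible_restrictField`):
  `ρ` irreducible and `ρ|_{Γ_K}` reducible, `[K : ℚ] = 2` ⟹ there is a continuous character
  `θ : Γ_K → GL₁(ℚ̄₂)` with `det(X - ρ(σ)) = det(X - Ind_{Γ_K}^{Γ_ℚ}(θ)(σ))` for every `σ ∈ Γ_ℚ`.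
* `isAutomorphicAE_of_isAutomorphicAE_induce` — hence **stub A for `ρ` follows from the automorphy
  of the induced representation `Ind θ` of its Clifford character** (the remaining, purely
  `GL₁`/CM, target: `θ` de Rham ⟹ algebraic Hecke character ⟹ automorphic induction).
* `isAutomorphicAE_of_tateTwistNewform` — the **newform entrance** at `ℓ = 2`: if some Tate twist
  `ρ ⊗ ε₂^m` is the Galois representation of a newform (for a CM `ρ` this is Hecke–Shimura's CM
  newform of `ψ`), then `IsAutomorphicAE ι hcpt ρ` — the landed dictionary
  `DyadicDihedralFM.stub_dictionary` read through `isAutomorphicAE_iff`.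
* `inducedCase_of_induceAutomorphic`, `inducedCase_of_tateTwistNewform` — the stub's registered
  signature, VERBATIM, derived from either residual target (pure logic).

What is NOT here (blueprint in the lead's `work/stubs/StubInducedCase.md`): the `GL₁` facts
"de Rham `2`-adic character of `Γ_K` ⟹ algebraic Hecke character" (Patrikis 2019, Prop. 2.2.1;
Serre 1968, Ch. III §2.3 and A.6–A.7), "de Rham passes from `Ind θ` to `θ`" (Patrikis 2019,
Lemma 7.2.1; Brinon–Conrad Prop. 6.3.8), "`K` real ⟹ equal weights" (Patrikis 2019, Lemma 2.2.4)
and the CM newform of a Hecke character (Ribet 1977, Thm. (3.4)–(3.5) = Shimura 1971, Lemma 3).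
-/

set_option linter.dupNamespace false -- project-wide option; `Summit.Langlands.Langlands` is the mandated namespace

noncomputable section

open scoped MatrixGroups Matrix Classical Polynomial NumberField ModularForm
open NumberField IsDedekindDomain Filter Field CongruenceSubgroup
open Literature.NumberTheory.Automorphic Literature.NumberTheory.GaloisRepresentations
open Literature.NumberTheory.EllipticCurves.ModularForms Literature.NumberTheory.PAdicHodge

namespace Summit.Langlands.Langlands.Theorems.DyadicEisensteinFM

/-! ### 1. Automorphy only sees characteristic polynomials -/

section Charpoly

variable {n : ℕ} {K : Type} [Field K] [NumberField K] {hcpt : isCompact_glFiniteIntegralLevel n K}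
  {ℓ : ℕ} [Fact ℓ.Prime] {ι : PadicAlgCl ℓ ≃+* ℂ}
  {π : AutomorphicRepData (AutomorphyDatum.gl n K hcpt)} {ρ ρ' : FramedGaloisRep K (PadicAlgCl ℓ) n}

/-- **Satake–Frobenius compatibility only sees characteristic polynomials.**  If
`det(X - ρ(σ)) = det(X - ρ'(σ))` for every `σ ∈ Γ_K`, `ρ` is unramified at almost all places, and
`π` is attached to `ρ'` at almost all places, then `π` is attached to `ρ` at almost all places
(the clause `HasFrobCharpolyAt` is a statement about `det(X - ρ(Frob))`; the unramifiedness of `ρ`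
is supplied separately because it is not a function of characteristic polynomials).
Serre 1968, Ch. I §2.3 (`P_{v,ρ}` is an invariant of the semisimplification). [folklore] -/
theorem satakeFrobCompatibleAE_of_charpoly_eq
    (h : ∀ σ : absoluteGaloisGroup K, FramedRep.charpoly ρ σ = FramedRep.charpoly ρ' σ)
    (hunr : ∀ᶠ v : HeightOneSpectrum (𝓞 K) in cofinite, ρ.IsUnramifiedAt v)
    (h' : SatakeFrobCompatibleAE ι π ρ') : SatakeFrobCompatibleAE ι π ρ := by
  filter_upwards [h', hunr] with v ⟨α, hα, _, hP⟩ hv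
  exact ⟨α, hα, hv, fun 𝔓 h𝔓 σ hσ => (h σ).trans (hP 𝔓 h𝔓 σ hσ)⟩

/-- **Automorphy only sees characteristic polynomials**: under the hypotheses of
`satakeFrobCompatibleAE_of_charpoly_eq`, `IsAutomorphicAE ι hcpt ρ'` implies
`IsAutomorphicAE ι hcpt ρ` (same `L`-algebraic cuspidal `π`). [folklore] -/
theorem isAutomorphicAE_of_charpoly_eq
    (h : ∀ σ : absoluteGaloisGroup K, FramedRep.charpoly ρ σ = FramedRep.charpoly ρ' σ)
    (hunr : ∀ᶠ v : HeightOneSpectrum (𝓞 K) in cofinite, ρ.IsUnramifiedAt v)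
    (h' : IsAutomorphicAE ι hcpt ρ') : IsAutomorphicAE ι hcpt ρ := by
  obtain ⟨π, hL, hπ⟩ := h'
  exact ⟨π, hL, satakeFrobCompatibleAE_of_charpoly_eq h hunr hπ⟩

end Charpoly

/-! ### 2. Clifford in rank two: a quadratically imprimitive irreducible `ρ` is induced from a character -/

/-- **Clifford's theorem, rank two.**  Let `A` be a topological field, `K` a quadratic number field
(`[K : ℚ] = 2`) and `ρ : Γ_ℚ → GL₂(A)` an irreducible framed Galois representation whose
restriction `ρ|_{Γ_K}` (`restrictField`, along the tree's `absGaloisRestrict ℚ K`) is NOT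
irreducible.  Then there is a continuous character `θ : Γ_K → GL₁(A)` with
`det(X - ρ(σ)) = det(X - Ind_{Γ_K}^{Γ_ℚ}(θ)(σ))` for every `σ ∈ Γ_ℚ` (`FramedGaloisRep.induce`),
i.e. `ρ ≅ Ind θ` at the level of characteristic polynomials (hence of traces, determinants and
all Frobenius data).  The rank-`2`, `m = 1` case of the landed
`exists_charpoly_eq_charpoly_induce_of_not_isIrreducible_restrictField`.
[cite: Clifford1937, Thm. 1] [cite: SerreLinearRepresentations1977, §7.3 Prop. 22] -/
theorem exists_character_charpoly_eq_induce {A : Type*} [Field A] [TopologicalSpace A]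
    [IsTopologicalRing A] (ρ : FramedGaloisRep ℚ A 2) (hirr : ρ.toGaloisRep.IsIrreducible)
    (K : Type) [Field K] [NumberField K] (hK : Module.finrank ℚ K = 2)
    (hred : ¬ (ρ.restrictField K).toGaloisRep.IsIrreducible) :
    ∃ θ : FramedGaloisRep K A 1, ∀ σ : absoluteGaloisGroup ℚ,
      FramedRep.charpoly ρ σ = FramedRep.charpoly (θ.induce ℚ hK) σ := by
  obtain ⟨m, s, hm, -, hchar⟩ :=
    Summit.Langlands.Langlands.Cruxes.QuadraticImprimitiveSurfaces.Clifford.exists_charpoly_eq_charpoly_induce_of_not_isIrreducible_restrictField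
      ℚ hK ρ hirr hred
  obtain rfl : m = 1 := by omega
  exact ⟨s, hchar⟩

/-! ### 3. Stub A follows from the automorphy of the induced Clifford character -/

/-- **Reduction of stub A to `GL₁`-over-`K`.**  For `ρ : Γ_ℚ → GL₂(ℚ̄_ℓ)` irreducible, unramified
almost everywhere and reducible on `Γ_K` (`[K : ℚ] = 2`), there is a continuous character
`θ : Γ_K → GL₁(ℚ̄_ℓ)` with `det(X - ρ) = det(X - Ind θ)` on `Γ_ℚ` such that, for every `hcpt`
and `ι`, the automorphy of `Ind_{Γ_K}^{Γ_ℚ} θ` implies the automorphy of `ρ` (Clifford +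
`isAutomorphicAE_of_charpoly_eq`).  What remains of stub A is therefore the CM dictionary for the
character `θ`. [cite: Clifford1937, Thm. 1] -/
theorem isAutomorphicAE_of_isAutomorphicAE_induce {ℓ : ℕ} [Fact ℓ.Prime]
    (ρ : FramedGaloisRep ℚ (PadicAlgCl ℓ) 2) (hirr : ρ.toGaloisRep.IsIrreducible)
    (hunr : ∀ᶠ v : HeightOneSpectrum (𝓞 ℚ) in cofinite, ρ.IsUnramifiedAt v)
    (K : Type) [Field K] [NumberField K] (hK : Module.finrank ℚ K = 2)
    (hred : ¬ (ρ.restrictField K).toGaloisRep.IsIrreducible) :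
    ∃ θ : FramedGaloisRep K (PadicAlgCl ℓ) 1,
      (∀ σ : absoluteGaloisGroup ℚ, FramedRep.charpoly ρ σ = FramedRep.charpoly (θ.induce ℚ hK) σ) ∧
      ∀ (hcpt : isCompact_glFiniteIntegralLevel 2 ℚ) (ι : PadicAlgCl ℓ ≃+* ℂ),
        IsAutomorphicAE ι hcpt (θ.induce ℚ hK) → IsAutomorphicAE ι hcpt ρ := by
  obtain ⟨θ, hθ⟩ := exists_character_charpoly_eq_induce ρ hirr K hK hred
  exact ⟨θ, hθ, fun hcpt ι h => isAutomorphicAE_of_charpoly_eq hθ hunr h⟩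

/-! ### 4. The newform entrance at `ℓ = 2` -/

/-- **Tate-twist newform ⟹ automorphic, at `ℓ = 2`.**  If for some `m ∈ ℤ` the Tate twist
`ρ ⊗ ε₂^m` of `ρ : Γ_ℚ → GL₂(ℚ̄₂)` is attached to a newform `f ∈ S_k(Γ₁(N))` away from `2N`
(`IsGaloisRepOfNewform1 f ι_f {q ∣ 2N} (ρ ⊗ χ)`, `χ = ε₂^m`), then `ρ` is automorphic in the
crux's sense: `IsAutomorphicAE ι hcpt ρ` for every `hcpt`, `ι` (the `L`-algebraic cuspidal
`π(f^τ) ⊗ |det|^{-m}`).  This is the landed dictionary `DyadicDihedralFM.stub_dictionary` at the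
prime `2`, read through `isAutomorphicAE_iff`; for a CM `ρ = Ind ψ̂` the newform is Hecke–Shimura's
`f_ψ` (Ribet 1977, Thm. (3.4)–(3.5)). [cite: BuzzardGeeLMS2014, Conj. 3.2.2 and Rem. 3.2.5] -/
theorem isAutomorphicAE_of_tateTwistNewform (ρ : FramedGaloisRep ℚ (PadicAlgCl 2) 2)
    (h : ∃ (χ : absoluteGaloisGroup ℚ →ₜ* (PadicAlgCl 2)ˣ) (m : ℤ),
      (∀ σ, χ σ = cyclotomicPadicAlgCl ℚ 2 σ ^ m) ∧
      ∃ (N : ℕ) (_ : NeZero N) (k : ℤ) (f : CuspForm (Gamma1 N) k)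
        (ιf : coeffCharField f →+* PadicAlgCl 2),
        IsNewform1 f ∧ IsGaloisRepOfNewform1 f ιf {q | q ∣ N * 2} (FramedRep.twist ρ χ))
    (hcpt : isCompact_glFiniteIntegralLevel 2 ℚ) (ι : PadicAlgCl 2 ≃+* ℂ) :
    IsAutomorphicAE ι hcpt ρ := by
  obtain ⟨π, hL, hπ⟩ := DyadicDihedralFM.stub_dictionary 2 ρ h hcpt ι
  exact ⟨π, hL, hπ⟩

/-! ### 5. The registered signature of stub A from either residual target -/

/-- **Stub A from the automorphy of induced Clifford characters.**  If, for every `ρ` with the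
stub's hypotheses, every quadratic `K` over which `ρ` becomes reducible and every character
`θ : Γ_K → GL₁(ℚ̄₂)` with `det(X - ρ) = det(X - Ind θ)`, the induced representation `Ind θ` is
automorphic, then stub A holds — verbatim the registered signature (Clifford supplies `θ`,
`isAutomorphicAE_of_charpoly_eq` transports the automorphy).  Pure logic over §2–§3. [folklore] -/
theorem inducedCase_of_induceAutomorphic : (∀ (ρ : Literature.NumberTheory.GaloisRepresentations.FramedGaloisRep ℚ (PadicAlgCl 2) 2), ρ.toGaloisRep.IsIrreducible → (∀ᶠ v : IsDedekindDomain.HeightOneSpectrum (NumberField.RingOfIntegers ℚ) in Filter.cofinite, ρ.IsUnramifiedAt v) → (∀ (v : IsDedekindDomain.HeightOneSpectrum (NumberField.RingOfIntegers ℚ)) (hv : ((2 : ℕ) : NumberField.RingOfIntegers ℚ) ∈ v.asIdeal), (Literature.NumberTheory.PAdicHodge.fontainePstAdicCompletion v 2 hv).IsDeRhamFramed (ρ.toLocal v) ∧ ∀ τ : v.adicCompletion ℚ →+* PadicAlgCl 2, Continuous τ → (ρ.labelledHodgeTateWeightsAt v (Literature.NumberTheory.PAdicHodge.fontainePstAdicCompletion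 v 2 hv).algebra (Literature.NumberTheory.PAdicHodge.fontainePstAdicCompletion v 2 hv).𝔅 τ).Nodup) → ∀ (K : Type) [Field K] [NumberField K] (hK : Module.finrank ℚ K = 2), ¬ (ρ.restrictField K).toGaloisRep.IsIrreducible → ∀ θ : Literature.NumberTheory.GaloisRepresentations.FramedGaloisRep K (PadicAlgCl 2) 1, (∀ σ : Field.absoluteGaloisGroup ℚ, Literature.NumberTheory.GaloisRepresentations.FramedRep.charpoly ρ σ = Literature.NumberTheory.GaloisRepresentations.FramedRep.charpoly (θ.induce ℚ hK) σ) → ∀ (hcpt : Literature.NumberTheory.Automorphic.isCompact_glFiniteIntegralLevel 2 ℚ) (ι : PadicAlgCl 2 ≃+* ℂ), Literature.NumberTheory.Automorphic.IsAutomorphicAE ι hcpt (θ.induce ℚ hK)) → ∀ (ρ : Literature.NumberTheory.GaloisRepresentations.FramedGaloisRep ℚ (PadicAlgCl 2) 2), ρ.toGaloisRep.IsIrreducible → (∀ᶠ v : IsDedekindDomain.HeightOneSpectrum (NumberField.RingOfIntegers ℚ) in Filter.cofinite, ρ.IsUnramifiedAt v) → (∀ (v : IsDedekindDomain.HeightOneSpectrum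 (NumberField.RingOfIntegers ℚ)) (hv : ((2 : ℕ) : NumberField.RingOfIntegers ℚ) ∈ v.asIdeal), (Literature.NumberTheory.PAdicHodge.fontainePstAdicCompletion v 2 hv).IsDeRhamFramed (ρ.toLocal v) ∧ ∀ τ : v.adicCompletion ℚ →+* PadicAlgCl 2, Continuous τ → (ρ.labelledHodgeTateWeightsAt v (Literature.NumberTheory.PAdicHodge.fontainePstAdicCompletion v 2 hv).algebra (Literature.NumberTheory.PAdicHodge.fontainePstAdicCompletion v 2 hv).𝔅 τ).Nodup) → (∃ (K : Type) (_ : Field K) (_ : NumberField K), Module.finrank ℚ K = 2 ∧ ¬ (ρ.restrictField K).toGaloisRep.IsIrreducible) → ∀ (hcpt : Literature.NumberTheory.Automorphic.isCompact_glFiniteIntegralLevel 2 ℚ) (ι : PadicAlgCl 2 ≃+* ℂ), Literature.NumberTheory.Automorphic.IsAutomorphicAE ι hcpt ρ := by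
  intro H ρ hirr hunr hdR hK hcpt ι
  obtain ⟨K, _, _, hK2, hred⟩ := hK
  obtain ⟨θ, hθ, himp⟩ := isAutomorphicAE_of_isAutomorphicAE_induce ρ hirr hunr K hK2 hred
  exact himp hcpt ι (H ρ hirr hunr hdR K hK2 hred θ hθ hcpt ι)

/-- **Stub A from CM Tate-twist newform modularity.**  If every `ρ` with the stub's hypotheses
which becomes reducible over a quadratic field has a Tate twist `ρ ⊗ ε₂^m` attached to a newform
(the CM newform `f_ψ` of the algebraic Hecke character `ψ` of the imaginary quadratic `K` whose
`2`-adic avatar induces `ρ`: Ribet 1977, Thm. (3.4)–(3.5) and (4.5); Serre 1968 Ch. III), then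
stub A holds — verbatim the registered signature, through `isAutomorphicAE_of_tateTwistNewform`.
Pure logic. [folklore] -/
theorem inducedCase_of_tateTwistNewform : (∀ (ρ : Literature.NumberTheory.GaloisRepresentations.FramedGaloisRep ℚ (PadicAlgCl 2) 2), ρ.toGaloisRep.IsIrreducible → (∀ᶠ v : IsDedekindDomain.HeightOneSpectrum (NumberField.RingOfIntegers ℚ) in Filter.cofinite, ρ.IsUnramifiedAt v) → (∀ (v : IsDedekindDomain.HeightOneSpectrum (NumberField.RingOfIntegers ℚ)) (hv : ((2 : ℕ) : NumberField.RingOfIntegers ℚ) ∈ v.asIdeal), (Literature.NumberTheory.PAdicHodge.fontainePstAdicCompletion v 2 hv).IsDeRhamFramed (ρ.toLocal v) ∧ ∀ τ : v.adicCompletion ℚ →+* PadicAlgCl 2, Continuous τ → (ρ.labelledHodgeTateWeightsAt v (Literature.NumberTheory.PAdicHodge.fontainePstAdicCompletion v 2 hv).algebra (Literature.NumberTheory.PAdicHodge.fontainePstAdicCompletion v 2 hv).𝔅 τ).Nodup) → (∃ (K : Type) (_ : Field K) (_ : NumberField K), Module.finrank ℚ K = 2 ∧ ¬ (ρ.restrictField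 K).toGaloisRep.IsIrreducible) → ∃ (χ : Field.absoluteGaloisGroup ℚ →ₜ* (PadicAlgCl 2)ˣ) (m : ℤ), (∀ σ, χ σ = Literature.NumberTheory.GaloisRepresentations.cyclotomicPadicAlgCl ℚ 2 σ ^ m) ∧ ∃ (N : ℕ) (_ : NeZero N) (k : ℤ) (f : CuspForm (CongruenceSubgroup.Gamma1 N) k) (ιf : Literature.NumberTheory.EllipticCurves.ModularForms.coeffCharField f →+* PadicAlgCl 2), Literature.NumberTheory.EllipticCurves.ModularForms.IsNewform1 f ∧ Literature.NumberTheory.EllipticCurves.ModularForms.IsGaloisRepOfNewform1 f ιf {q | q ∣ N * 2} (Literature.NumberTheory.GaloisRepresentations.FramedRep.twist ρ χ)) → ∀ (ρ : Literature.NumberTheory.GaloisRepresentations.FramedGaloisRep ℚ (PadicAlgCl 2) 2), ρ.toGaloisRep.IsIrreducible → (∀ᶠ v : IsDedekindDomain.HeightOneSpectrum (NumberField.RingOfIntegers ℚ) in Filter.cofinite, ρ.IsUnramifiedAt v) → (∀ (v : IsDedekindDomain.HeightOneSpectrum (NumberField.RingOfIntegers ℚ)) (hv : ((2 : ℕ)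 : NumberField.RingOfIntegers ℚ) ∈ v.asIdeal), (Literature.NumberTheory.PAdicHodge.fontainePstAdicCompletion v 2 hv).IsDeRhamFramed (ρ.toLocal v) ∧ ∀ τ : v.adicCompletion ℚ →+* PadicAlgCl 2, Continuous τ → (ρ.labelledHodgeTateWeightsAt v (Literature.NumberTheory.PAdicHodge.fontainePstAdicCompletion v 2 hv).algebra (Literature.NumberTheory.PAdicHodge.fontainePstAdicCompletion v 2 hv).𝔅 τ).Nodup) → (∃ (K : Type) (_ : Field K) (_ : NumberField K), Module.finrank ℚ K = 2 ∧ ¬ (ρ.restrictField K).toGaloisRep.IsIrreducible) → ∀ (hcpt : Literature.NumberTheory.Automorphic.isCompact_glFiniteIntegralLevel 2 ℚ) (ι : PadicAlgCl 2 ≃+* ℂ), Literature.NumberTheory.Automorphic.IsAutomorphicAE ι hcpt ρ := by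
  intro H ρ hirr hunr hdR hK hcpt ι
  exact isAutomorphicAE_of_tateTwistNewform ρ (H ρ hirr hunr hdR hK) hcpt ι

end Summit.Langlands.Langlands.Theorems.DyadicEisensteinFM

end
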